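import Mathlib
import HarnessLib
import Summits.Ventures.LatticeQCDFlow.Exactness.U1MultiStepLeapfrogHMC
import Summits.Ventures.LatticeQCDFlow.Exactness.U1LeapfrogHMCWilson

/-!
# Multi-step leapfrog HMC on `U(1)` lattice gauge fields is uniformly ergodic for short trajectories — every `nstep`, and the Wilson instance

HONEST FRAMING: exact (Metropolis-corrected) sampling algorithms for lattice gauge theory;
figures of merit are autocorrelation/cost numbers at stated couplings and volumes; no
continuum-physics claim.

Venture `LatticeQCDFlow` (cell pub-lqcd), topic `Exactness`, FANOUT row 9 (eng-latcore, the
engine `latflow.core.u1_2d.U1Field2D.hmc_trajectory(β, τ, nstep)` / `hmc.HMC(f, β, 'leapfrog')`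
on the `U(1)` rung, NOW AT EVERY `nstep`).  NEW WORK of the cell over Mathlib and the tree (part 1
`U1MultiStepLeapfrogHMC.lean`: the kernel `u1LeapfrogHMCN`, exactness, the angle lift, the energy
window and the position law of a short trajectory; `LeapfrogShortTrajectory.lean`,
`ApproxDilationPushforward.lean`; `LeapfrogHMCDoeblin.refreshUpdate_involMH_minorised`;
`U1LeapfrogHMCErgodic.lean` (the `nstep = 1` file, whose momentum-box minorant is reused);
`U1LeapfrogHMCWilson.lean` (the Gibbs law of `β S_W` is the Literature's `wilsonMeasure`)); nothing
here is cited as a fact.  Printed counterparts, named only: Duane–Kennedy–Pendleton–Roweth 1987,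
Mackenzie 1989 (fixed-length trajectories can be non-ergodic), Bou-Rabee–Sanz-Serna 2017,
Durmus–Moulines–Saksman 2020 (irreducibility of HMC under step-size conditions), Meyn–Tweedie ch. 16.

THE TREE LISTED "`nstep ≥ 2` ergodicity: not typed, no hypothesis-free theorem expected" (gen-13 to
gen-16 closes).  THIS FILE TYPES IT UNDER THE SHORT-TRAJECTORY HYPOTHESIS `4·Lip(g)·ε·n² ≤ 3`
(`g` = the half-kick increment, `K`-Lipschitz for the sup distances; in force units
`Lip(∂S)·τ² ≤ 3/2`, `τ = nε`), for links `U : ι → U(1)`, `ι` finite: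

* §1 **`u1LeapfrogHMCN_minorised`** — DOEBLIN IN ONE STEP: for `ε > 0`, `κ > 0`, `n ≥ 1`, `g`
  measurable, `K`-Lipschitz, bounded by `b ≥ 0`, `4Kεn² ≤ 3`, and a measurable action bounded by
  `s`: `∃ δ > 0, ∀ U, K_n(U, ·) ≥ δ • Haar^{⊗ι}` (the Gaussian refresh dominates box-uniform momenta on
  the box `R_n = 3(π + εbn²)/(2nε)`; the energy window bounds the acceptance below by
  `e^{−(2s + κ|ι|(R_n + 2(n+1)b)²)}`; the position law dominates `((3/(4nε))·2π)^{|ι|} •` Haar — part 1);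
* §2 **`u1LeapfrogHMCN_uniformlyErgodic`** — `∃ δ ∈ (0, 1]`: `|μ₀K_nᵗ(A) − π_S(A)| ≤ (1 − δ)ᵗ` for
  EVERY initial law, every `t`, every set; **`u1LeapfrogHMCN_invariant_unique`** — `π_S =
  Z_S⁻¹e^{−S}·Haar^{⊗ι}` is the ONLY invariant probability law; `u1LeapfrogHMCN_comp_uniformlyErgodic`
  — the same for `η ∘ₖ K_n`, `η` ANY exact Markov kernel (the rest of a `composite_sweep`);
* §3 THE ENGINE INSTANCE: **`wilson_u1LeapfrogHMCN_uniformlyErgodic`** /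
  **`wilsonMeasure_unique_invariant_u1LeapfrogHMCN`** — on the torus `(ℤ/L)^d` with the Wilson
  action `β S_W` of any continuous representation of `U(1)`, the `n`-step leapfrog HMC chain with
  any such increment converges to the Literature's `wilsonMeasure ρ β` from every start, which is its
  unique invariant law.

NOT CLAIMED: anything when `4·Lip(g)·ε·n² > 3` (nothing is asserted for long trajectories; the
engine's `tau_jitter` exists for the resonances of Mackenzie 1989); that the engine's exact force
satisfies a particular Lipschitz constant (any `K` with `4Kεn² ≤ 3` is covered; the Wilson force's
`K` is `O(β ε d)` and is not computed here); OMF words; `SU(N)` / `CP(N−1)`; any useful RATE (`δ`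
is astronomically small); floating point.
-/

noncomputable section

namespace Summit.Ventures.LatticeQCDFlow.Exactness

open MeasureTheory ProbabilityTheory ProbabilityTheory.Kernel Set Metric Function
open Literature.MathematicalPhysics.QuantumFieldTheory
open scoped ENNReal NNReal

variable {ι : Type*}

/-! ## §1 Doeblin in one step -/

section Doeblin

variable [Fintype ι] {ε κ : ℝ} {g : (ι → Circle) → ι → ℝ} {b : ℝ} {n : ℕ} {K : ℝ≥0}

/-- **DOEBLIN FOR `n`-STEP LEAPFROG HMC ON `U(1)^ι` (SHORT TRAJECTORIES).**  `ε > 0`, `κ > 0`,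
`n ≥ 1`; the increment `g` measurable, `K`-Lipschitz with `4 K ε n² ≤ 3` and bounded by `b ≥ 0`;
the action measurable and bounded by `s`.  Then there is `δ > 0` with `K_n(U, ·) ≥ δ · Haar^{⊗ι}`
from EVERY configuration `U`. -/
theorem u1LeapfrogHMCN_minorised (hε : 0 < ε) (hκ : 0 < κ) (hn : 1 ≤ n) (hg : Measurable g)
    (hgK : LipschitzWith K g) (hshort : 4 * (K : ℝ) * ε * (n : ℝ) ^ 2 ≤ 3) (hb0 : 0 ≤ b)
    (hb : ∀ u l, ‖g u l‖ ≤ b) {S : (ι → Circle) → ℝ} (hS : Measurable S)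
    {s : ℝ} (hs : ∀ u, |S u| ≤ s) :
    ∃ δ : ℝ≥0∞, 0 < δ ∧ ∀ u, δ • Measure.pi (fun _ : ι => haarProbability (Circle)) ≤
      u1LeapfrogHMCN ε κ hg S n u := by
  classical
  haveI : Fact (0 < κ) := ⟨hκ⟩
  set R : ℝ := shortTrajRadius ε b n with hR
  have hR0 : 0 < R := shortTrajRadius_pos hε hb0 hn
  set c : ℝ≥0∞ := (u1MomentumWeight (ι := ι) κ univ)⁻¹ *
    ENNReal.ofReal (Real.exp (-(κ * (Fintype.card ι * R ^ 2)))) with hc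
  set B : ℝ := 2 * s + κ * (Fintype.card ι * (R + 2 * ((n : ℝ) + 1) * b) ^ 2) with hB
  set θ : ℝ≥0∞ := ENNReal.ofReal ((4 * ((n : ℝ) * ε) / 3)⁻¹ ^ Fintype.card ι) *
    ENNReal.ofReal (2 * Real.pi) ^ Fintype.card ι with hθ
  have hH : Measurable fun z : (ι → Circle) × (ι → ℝ) => S z.1 + u1Kinetic κ z.2 :=
    (hS.comp measurable_fst).add ((measurable_u1Kinetic κ).comp measurable_snd)
  have hs0 : 0 ≤ s := (abs_nonneg _).trans (hs fun _ => 1)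
  have hB0 : 0 ≤ B := by positivity
  have hn' : (1 : ℝ) ≤ n := by exact_mod_cast hn
  refine ⟨ENNReal.ofReal (Real.exp (-B)) * (c * θ), ?_, fun u => ?_⟩
  · refine ENNReal.mul_pos (ENNReal.ofReal_pos.2 (Real.exp_pos _)).ne'
      (mul_ne_zero (mul_ne_zero ?_ ?_) (mul_ne_zero ?_ ?_))
    · exact ENNReal.inv_ne_zero.2 (u1MomentumWeight_univ_ne_top hκ)
    · exact (ENNReal.ofReal_pos.2 (Real.exp_pos _)).ne'
    · exact (ENNReal.ofReal_pos.2 (pow_pos (inv_pos.2 (by positivity)) _)).ne'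
    · exact pow_ne_zero _ (ENNReal.ofReal_pos.2 (by positivity)).ne'
  · refine refreshUpdate_involMH_minorised (measurable_u1LeapfrogProposalN ε n hg) hH (u1MomentumLaw κ)
      (ρ := c • volume.restrict (u1MomBox (ι := ι) R)) (smul_restrict_u1MomBox_le_u1MomentumLaw hκ R)
      (fun v => Measure.ae_smul_measure ((ae_restrict_iff' (measurableSet_u1MomBox R)).2
        (Filter.Eventually.of_forall fun p hp => le_involAcceptE_of_le hB0
          (u1LeapfrogN_energy_window v hκ.le hb0 hb hs hR0.le n (norm_le_of_mem_u1MomBox hp)))) _)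
      (fun v => ?_) u
    rw [Measure.map_smul, mul_smul]
    exact measure_smul_le_smul_of_le (smul_pi_haar_le_map_fst_u1LeapfrogProposalN hε hn hgK hshort hb0 hb v) _

end Doeblin

/-! ## §2 Uniform ergodicity from every start; uniqueness of the invariant law -/

section Ergodic

variable [Fintype ι] {ε κ : ℝ} {g : (ι → Circle) → ι → ℝ} {b : ℝ} {n : ℕ} {K : ℝ≥0}
  {S : (ι → Circle) → ℝ} {s : ℝ}

/-- **`n`-STEP LEAPFROG HMC ON `U(1)^ι` IS UNIFORMLY ERGODIC FOR SHORT TRAJECTORIES.**  Under the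
hypotheses of `u1LeapfrogHMCN_minorised` there is `δ ∈ (0, 1]` such that for EVERY initial law `μ₀`,
every `t` and every set `A`, `|μ₀K_nᵗ(A) − π_S(A)| ≤ (1 − δ)ᵗ`, `π_S = Z_S⁻¹ e^{−S} · Haar^{⊗ι}`. -/
theorem u1LeapfrogHMCN_uniformlyErgodic (hε : 0 < ε) (hκ : 0 < κ) (hn : 1 ≤ n) (hg : Measurable g)
    (hgK : LipschitzWith K g) (hshort : 4 * (K : ℝ) * ε * (n : ℝ) ^ 2 ≤ 3) (hb0 : 0 ≤ b)
    (hb : ∀ u l, ‖g u l‖ ≤ b) (hS : Measurable S) (hs : ∀ u, |S u| ≤ s) :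
    ∃ δ : ℝ, 0 < δ ∧ δ ≤ 1 ∧ ∀ (μ₀ : Measure (ι → Circle))
      [IsProbabilityMeasure μ₀] (t : ℕ) (A : Set (ι → Circle)),
      |((fun m : Measure (ι → Circle) => m.bind (u1LeapfrogHMCN ε κ hg S n))^[t] μ₀).real A
          - (u1GibbsLaw S).real A| ≤ (1 - δ) ^ t := by
  haveI : Fact (0 < κ) := ⟨hκ⟩
  haveI := isProbabilityMeasure_u1GibbsLaw (ι := ι) hs
  obtain ⟨δ, hδ0, hmin⟩ := u1LeapfrogHMCN_minorised hε hκ hn hg hgK hshort hb0 hb hS hs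
  have hH : Measurable fun z : (ι → Circle) × (ι → ℝ) => S z.1 + u1Kinetic κ z.2 :=
    (hS.comp measurable_fst).add ((measurable_u1Kinetic κ).comp measurable_snd)
  haveI : Fact (Measurable fun z : (ι → Circle) × (ι → ℝ) => S z.1 + u1Kinetic κ z.2) := ⟨hH⟩
  haveI : IsMarkovKernel (u1LeapfrogHMCN ε κ hg S n) := by unfold u1LeapfrogHMCN; infer_instance
  have hδ1 : δ ≤ 1 := by
    have h := Measure.le_iff'.1 (hmin fun _ => 1) univ
    rwa [Measure.smul_apply, smul_eq_mul, measure_univ, measure_univ, mul_one] at h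
  have hδtop : δ ≠ ⊤ := ne_top_of_le_ne_top ENNReal.one_ne_top hδ1
  refine ⟨δ.toReal, ENNReal.toReal_pos hδ0.ne' hδtop,
    ENNReal.toReal_le_of_le_ofReal zero_le_one (by rwa [ENNReal.ofReal_one]), fun μ₀ _ t A => ?_⟩
  exact refreshUpdate_involMH_uniformlyErgodic (measurable_u1LeapfrogProposalN ε n hg) hH
    (u1MomentumLaw κ) hmin (u1LeapfrogHMCN_invariant_gibbsLaw hκ hg hS n) μ₀ t A

/-- **The Gibbs law is the unique invariant probability law** of `n`-step leapfrog HMC on `U(1)^ι`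
under the short-trajectory hypotheses. -/
theorem u1LeapfrogHMCN_invariant_unique (hε : 0 < ε) (hκ : 0 < κ) (hn : 1 ≤ n) (hg : Measurable g)
    (hgK : LipschitzWith K g) (hshort : 4 * (K : ℝ) * ε * (n : ℝ) ^ 2 ≤ 3) (hb0 : 0 ≤ b)
    (hb : ∀ u l, ‖g u l‖ ≤ b) (hS : Measurable S) (hs : ∀ u, |S u| ≤ s)
    {π' : Measure (ι → Circle)} [IsProbabilityMeasure π']
    (hπ' : Invariant (u1LeapfrogHMCN ε κ hg S n) π') : π' = u1GibbsLaw S := by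
  haveI : Fact (0 < κ) := ⟨hκ⟩
  haveI := isProbabilityMeasure_u1GibbsLaw (ι := ι) hs
  obtain ⟨δ, hδ0, hmin⟩ := u1LeapfrogHMCN_minorised hε hκ hn hg hgK hshort hb0 hb hS hs
  have hH : Measurable fun z : (ι → Circle) × (ι → ℝ) => S z.1 + u1Kinetic κ z.2 :=
    (hS.comp measurable_fst).add ((measurable_u1Kinetic κ).comp measurable_snd)
  exact refreshUpdate_involMH_invariant_unique (measurable_u1LeapfrogProposalN ε n hg) hH
    (u1MomentumLaw κ) hmin hδ0 (u1LeapfrogHMCN_invariant_gibbsLaw hκ hg hS n) hπ'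

/-- **… followed by ANY exact Markov kernel** (longer trajectories, over-relaxation, another HMC call
— every further step of a `composite_sweep` that leaves `e^{−S}·Haar^{⊗ι}` invariant): the
composite `η ∘ₖ K_n` still converges to `π_S` from every start at the same geometric rate (the
one-step Doeblin minorant survives post-composition, `RefreshScan.minorised_comp_left`). -/
theorem u1LeapfrogHMCN_comp_uniformlyErgodic (hε : 0 < ε) (hκ : 0 < κ) (hn : 1 ≤ n)
    (hg : Measurable g) (hgK : LipschitzWith K g) (hshort : 4 * (K : ℝ) * ε * (n : ℝ) ^ 2 ≤ 3)
    (hb0 : 0 ≤ b) (hb : ∀ u l, ‖g u l‖ ≤ b) (hS : Measurable S) (hs : ∀ u, |S u| ≤ s)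
    (η : Kernel (ι → Circle) (ι → Circle)) [IsMarkovKernel η]
    (hη : Invariant η ((Measure.pi fun _ : ι => haarProbability (Circle)).withDensity
      fun u => ENNReal.ofReal (Real.exp (-S u)))) :
    ∃ δ : ℝ, 0 < δ ∧ δ ≤ 1 ∧ ∀ (μ₀ : Measure (ι → Circle))
      [IsProbabilityMeasure μ₀] (t : ℕ) (A : Set (ι → Circle)),
      |((fun m : Measure (ι → Circle) => m.bind (η ∘ₖ u1LeapfrogHMCN ε κ hg S n))^[t] μ₀).real A
          - (u1GibbsLaw S).real A| ≤ (1 - δ) ^ t := by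
  haveI : Fact (0 < κ) := ⟨hκ⟩
  haveI := isProbabilityMeasure_u1GibbsLaw (ι := ι) hs
  obtain ⟨δ, hδ0, hmin⟩ := u1LeapfrogHMCN_minorised hε hκ hn hg hgK hshort hb0 hb hS hs
  have hH : Measurable fun z : (ι → Circle) × (ι → ℝ) => S z.1 + u1Kinetic κ z.2 :=
    (hS.comp measurable_fst).add ((measurable_u1Kinetic κ).comp measurable_snd)
  haveI : Fact (Measurable fun z : (ι → Circle) × (ι → ℝ) => S z.1 + u1Kinetic κ z.2) := ⟨hH⟩
  haveI : IsMarkovKernel (u1LeapfrogHMCN ε κ hg S n) := by unfold u1LeapfrogHMCN; infer_instance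
  have hδ1 : δ ≤ 1 := by
    have h := Measure.le_iff'.1 (hmin fun _ => 1) univ
    rwa [Measure.smul_apply, smul_eq_mul, measure_univ, measure_univ, mul_one] at h
  have hδtop : δ ≠ ⊤ := ne_top_of_le_ne_top ENNReal.one_ne_top hδ1
  have hmin' := fun a => minorised_comp_left hmin η a
  have hinv : Invariant (η ∘ₖ u1LeapfrogHMCN ε κ hg S n) (u1GibbsLaw S) :=
    (invariant_smul hη _).comp (u1LeapfrogHMCN_invariant_gibbsLaw hκ hg hS n)
  refine ⟨δ.toReal, ENNReal.toReal_pos hδ0.ne' hδtop,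
    ENNReal.toReal_le_of_le_ofReal zero_le_one (by rwa [ENNReal.ofReal_one]), fun μ₀ _ t A => ?_⟩
  exact uniformlyErgodic_of_minorised hmin' hinv μ₀ t A

end Ergodic

/-! ## §3 The engine instance: the Wilson action of `U(1)` lattice gauge theory on the torus -/

section Wilson

variable {d L N : ℕ} (ρ : Circle →* Matrix (Fin N) (Fin N) ℂ)

/-- **`n`-STEP LEAPFROG HMC CONVERGES TO THE WILSON MEASURE FROM EVERY START (SHORT TRAJECTORIES).**
Torus `(ℤ/L)^d`, `G = U(1)` with a continuous representation `ρ`, any real `β`; the engine's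
configuration kernel with `n ≥ 1` P-first leapfrog steps of size `ε > 0`, Gaussian momenta with
kinetic coefficient `κ > 0`, a measurable `K`-Lipschitz increment bounded by `b ≥ 0` with
`4 K ε n² ≤ 3`, Metropolis test on `β S_W + T_κ`: there is `δ ∈ (0, 1]` with
`|μ₀K_nᵗ(A) − μ_{Λ,β}(A)| ≤ (1 − δ)ᵗ` for every initial law `μ₀`, every `t`, every set `A`. -/
theorem wilson_u1LeapfrogHMCN_uniformlyErgodic [NeZero L] (hρ : Continuous ρ) (β : ℝ) {ε κ : ℝ}
    (hε : 0 < ε) (hκ : 0 < κ) {n : ℕ} (hn : 1 ≤ n)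
    {g : GaugeConfig d L (Circle) → Edge d L → ℝ} (hg : Measurable g) {K : ℝ≥0}
    (hgK : LipschitzWith K g) (hshort : 4 * (K : ℝ) * ε * (n : ℝ) ^ 2 ≤ 3)
    {b : ℝ} (hb0 : 0 ≤ b) (hb : ∀ U e, ‖g U e‖ ≤ b) :
    ∃ δ : ℝ, 0 < δ ∧ δ ≤ 1 ∧
      ∀ (μ₀ : Measure (GaugeConfig d L (Circle))) [IsProbabilityMeasure μ₀]
        (t : ℕ) (A : Set (GaugeConfig d L (Circle))),
        |((fun m : Measure (GaugeConfig d L (Circle)) =>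
              m.bind (u1LeapfrogHMCN ε κ hg (fun U => β * wilsonAction ρ U) n))^[t] μ₀).real A
            - (wilsonMeasure ρ β).real A| ≤ (1 - δ) ^ t := by
  obtain ⟨s, hs⟩ := exists_bound_smul_wilsonAction_circle (d := d) (L := L) ρ hρ β
  rw [← u1GibbsLaw_eq_wilsonMeasure (d := d) (L := L) ρ β]
  exact u1LeapfrogHMCN_uniformlyErgodic hε hκ hn hg hgK hshort hb0 hb
    (continuous_smul_wilsonAction ρ hρ β).measurable hs

/-- **The Wilson measure is the unique invariant probability law of `n`-step leapfrog HMC** on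
`U(1)` lattice gauge fields (same hypotheses). -/
theorem wilsonMeasure_unique_invariant_u1LeapfrogHMCN [NeZero L] (hρ : Continuous ρ) (β : ℝ)
    {ε κ : ℝ} (hε : 0 < ε) (hκ : 0 < κ) {n : ℕ} (hn : 1 ≤ n)
    {g : GaugeConfig d L (Circle) → Edge d L → ℝ} (hg : Measurable g) {K : ℝ≥0}
    (hgK : LipschitzWith K g) (hshort : 4 * (K : ℝ) * ε * (n : ℝ) ^ 2 ≤ 3)
    {b : ℝ} (hb0 : 0 ≤ b) (hb : ∀ U e, ‖g U e‖ ≤ b)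
    {π' : Measure (GaugeConfig d L (Circle))} [IsProbabilityMeasure π']
    (hπ' : Invariant (u1LeapfrogHMCN ε κ hg (fun U => β * wilsonAction ρ U) n) π') :
    π' = wilsonMeasure ρ β := by
  obtain ⟨s, hs⟩ := exists_bound_smul_wilsonAction_circle (d := d) (L := L) ρ hρ β
  rw [← u1GibbsLaw_eq_wilsonMeasure (d := d) (L := L) ρ β]
  exact u1LeapfrogHMCN_invariant_unique hε hκ hn hg hgK hshort hb0 hb
    (continuous_smul_wilsonAction ρ hρ β).measurable hs hπ'

end Wilson

end Summit.Ventures.LatticeQCDFlow.Exactness
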